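import Literature.Probability.Percolation.ZdFiveArmUniqueness
import HarnessLib

/-!
# The lowest open crossing of a rectangle of `ℤ²`: the dual region below, the faces above, the frontier

Topic `Literature/Probability/Percolation`; bond percolation on `ℤ² = Site 2`. PROOFS AND
DEFINITIONS ONLY (no named fact). First file of the bond-`ℤ²` rendering of Nolin's construction
of a five-arm vertex on the lowest crossing (P. Nolin, *Near-critical percolation in two
dimensions*, EJP 13 (2008), §5.2, proof of Thm. 24 (ii) [arXiv 0711.4948: Thm. 23 (ii)]:
"condition on the lowest black left-right crossing `c` … the percolation in the region above it
remains unbiased"; H. Kesten, *Percolation theory for mathematicians* (1982), §2.3, Prop. 2.3;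
B. Bollobás, O. Riordan, *Percolation* (2006), Ch. 3, Lemma 1 and proof of Lemma 4), the input of
the two-radii five-arm lower bound `P_{1/2}[𝒜₅(A_{m,n})] ≥ c (m/n)²` for bond percolation on `ℤ²`
(`zdFiveArmClusters`, `ZdFourArmFromFiveArm.lean`; DMT 2021, Prop. 6.6; the site-`𝕋` twin of this
construction is `FiveArmFrontier.lean` … `FiveArmLowerBound.lean`).  For the rectangle
`R = [0,M] × [0,N]` and its dual rectangle `R* = [0,M-1] × [-1,N]` of faces (lower-left corners,
`Crossings.lean`):

* `dualBelowR M N ω` — the faces of `R*` joined to the bottom face row by a dual-open (= crossing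
  closed edges) path of `R*`: the region below the lowest open left–right crossing (the tree's
  `dualBelow j ω` of `LowestCrossing.lean`, for rectangles); locality `determinedBy_dualBelowR_eq`
  (by the edges bounding its faces, `belowEdges`), `mem_of_adj_dualBelowR` (its boundary edges
  inside `R*` are open);
* `IsAboveFace M N ω f` — `f ∈ R*` lies off `dualBelowR` and is joined to the top face row by
  faces of `R*` off `dualBelowR` (arbitrary steps): the region above the lowest crossing;
* `IsLowEdge M N ω e` — `e` separates a face of `dualBelowR` from an above face: the edges of
  the lowest crossing (`isLowEdge_mem`: they are open; `exists_lowWalk`: they contain a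
  left–right lattice walk of `R`, by the parity lemma; `IsLowEdge.mem_edges_of_walk`: conversely
  every such edge lies on every left–right walk made of such edges, by the crossing lemma
  `exists_dart_sepEdge_mem_edges`), whence `exists_lowPath`: **the lowest crossing is a simple
  left–right path `λ` of `R` whose edge set is exactly the set of low edges**;
* `IsAboveVertex` — a vertex of `R` off `λ` around which some face is an above face; then every
  face of `R*` around it is an above face (`IsAboveVertex.isAboveFace_of_corner`), and no
  neighbour of it in `R` is a below vertex (`IsAboveVertex.of_adj`).

## References

* P. Nolin, EJP 13 (2008) 1562–1623, §5.2, proof of Thm. 24 (ii) (arXiv 0711.4948: Thm. 23 (ii))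
  [Nolin2008].
* H. Kesten, *Percolation theory for mathematicians*, Birkhäuser (1982), §2.2–2.3 [KestenPTM1982].
* B. Bollobás, O. Riordan, *Percolation*, CUP (2006), Ch. 3, Lemma 1, proof of Lemma 4
  [BollobasRiordan2006].

## Tree

`exists_faceWalk_of_bottom_top`, `dualBelow`, `belowEdges`, `squareEdges`
(`LowestCrossing.lean`); `exists_dart_sepEdge_mem_edges`, `sepEdge`, `dualEdge_sepEdge`,
`openConnIn` API (`PlanarDuality.lean`); `dualRectangle`, `dualConfig`, `dualEdge`
(`Crossings.lean`).
-/

noncomputable section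

open SimpleGraph Finset

namespace Literature.Probability.Percolation

open LatticeModels

variable {M N : ℕ} {ω : BondConfig (Site 2)}

/-! ### The dual region below the lowest crossing -/

open Classical in
/-- **The faces below the lowest open crossing** of `R = [0,M] × [0,N]`: the faces of the dual
rectangle `R* = [0,M-1] × [-1,N]` joined to its bottom row by a dual-open path of `R*` (the
tree's `dualBelow j ω`, `LowestCrossing.lean`, for rectangles; Kesten 1982, §2.3;
Bollobás–Riordan 2006, Ch. 3, proof of Lemma 4, `LV(S)`). [cite: BollobasRiordan2006, Ch. 3, Lemma 1 and proof of Lemma 4 (the lowest crossing)] -/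
def dualBelowR (M N : ℕ) (ω : BondConfig (Site 2)) : Finset (Site 2) :=
  (dualRectangle M N).filter fun f => ∃ b ∈ dualBottomSide M N,
    dualConfig ω ∈ openConnIn (↑(dualRectangle M N) : Set (Site 2)) b f

/-- Membership in `dualBelowR`. [folklore] -/
theorem mem_dualBelowR_iff {f : Site 2} : f ∈ dualBelowR M N ω ↔ f ∈ dualRectangle M N ∧
    ∃ b ∈ dualBottomSide M N, dualConfig ω ∈ openConnIn (↑(dualRectangle M N) : Set (Site 2)) b f := by
  classical
  simp [dualBelowR]

/-- `dualBelowR ⊆ R*`. [folklore] -/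
theorem dualBelowR_subset : dualBelowR M N ω ⊆ dualRectangle M N := fun _ h => (mem_dualBelowR_iff.1 h).1

/-- The bottom face row lies below. [folklore] -/
theorem mem_dualBelowR_of_mem_dualBottomSide {f : Site 2} (hf : f ∈ dualBottomSide M N) :
    f ∈ dualBelowR M N ω := by
  have hfD : f ∈ dualRectangle M N := (Finset.mem_filter.1 hf).1
  exact mem_dualBelowR_iff.2 ⟨hfD, f, hf, openConnIn_refl (Finset.mem_coe.2 hfD)⟩

/-- `dualBelowR` is closed under dual-open steps inside `R*`. [folklore] -/
theorem mem_dualBelowR_of_adj {f f' : Site 2} (hf : f ∈ dualBelowR M N ω) (hf' : f' ∈ dualRectangle M N)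
    (he : s(f, f') ∈ dualConfig ω) : f' ∈ dualBelowR M N ω := by
  obtain ⟨hfD, b, hb, hconn⟩ := mem_dualBelowR_iff.1 hf
  have hne : f ≠ f' := ((zdGraph 2).mem_edgeSet.1 (mem_dualConfig_iff.1 he).1).ne
  exact mem_dualBelowR_iff.2 ⟨hf', b, hb, PlanarDuality.openConnIn_trans hconn
    (openConnIn_of_adj (Finset.mem_coe.2 hfD) (Finset.mem_coe.2 hf') he hne)⟩

/-- Every face below is joined to the bottom row by a dual-open path INSIDE `dualBelowR`.
[folklore] -/
theorem exists_openConnIn_dualBelowR {f : Site 2} (hf : f ∈ dualBelowR M N ω) :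
    ∃ b ∈ dualBottomSide M N, dualConfig ω ∈ openConnIn (↑(dualBelowR M N ω) : Set (Site 2)) b f := by
  classical
  obtain ⟨-, b, hb, hconn⟩ := mem_dualBelowR_iff.1 hf
  obtain ⟨W, hWS, hWω⟩ :=
    exists_walk_of_mem_openConnIn (fun _ h => h.1 : dualConfig ω ⊆ (zdGraph 2).edgeSet) hconn
  refine ⟨b, hb, mem_openConnIn_of_walk W (fun z hz => ?_) hWω⟩
  exact Finset.mem_coe.2 (mem_dualBelowR_iff.2 ⟨hWS z hz, b, hb, mem_openConnIn_of_mem_support W hWS hWω hz⟩)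

/-- For a lattice configuration, the dual edge of two adjacent faces is dual-open iff the primal
edge separating them is closed. [folklore] -/
theorem mem_dualConfig_mk_iff (hω : ω ⊆ (zdGraph 2).edgeSet) {z z' : Site 2} (h : (zdGraph 2).Adj z z') :
    s(z, z') ∈ dualConfig ω ↔ sepEdge z z' ∉ ω := by
  refine ⟨ZdDual.sepEdge_not_mem_of_mem_dualConfig h, fun hne => ?_⟩
  rw [mem_dualConfig_iff]
  refine ⟨h, fun e' he' heq => ?_⟩
  rw [← dualEdge_sepEdge h] at heq
  have := dualEdge_injOn_holds (hω he') (sepEdge_mem_edgeSet h) heq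
  exact hne (this ▸ he')

/-- **The boundary of the region below is open**: an edge separating a face below from a face of
`R*` that is not below is open (lattice configurations). [folklore] -/
theorem mem_of_adj_dualBelowR (hω : ω ⊆ (zdGraph 2).edgeSet) {g f : Site 2} (hg : g ∈ dualBelowR M N ω)
    (hf : f ∈ dualRectangle M N) (hfB : f ∉ dualBelowR M N ω) (h : (zdGraph 2).Adj g f) :
    sepEdge g f ∈ ω := by
  by_contra hne
  exact hfB (mem_dualBelowR_of_adj hg hf ((mem_dualConfig_mk_iff hω h).2 hne))

/-! ### Locality of `{dualBelowR = D₀}` -/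

/-- One direction of the locality of `{dualBelowR = D₀}` (verbatim the argument of
`dualBelow_eq_of_inter_eq`). [folklore] -/
theorem dualBelowR_eq_of_inter_eq {D₀ : Finset (Site 2)} {ω ω' : BondConfig (Site 2)}
    (h : ω ∩ ↑(belowEdges D₀) = ω' ∩ ↑(belowEdges D₀)) (hD : dualBelowR M N ω = D₀) :
    dualBelowR M N ω' = D₀ := by
  classical
  have hDR : D₀ ⊆ dualRectangle M N := hD ▸ dualBelowR_subset
  apply Finset.Subset.antisymm
  · intro f hf
    by_contra hfD
    obtain ⟨hfR, b, hb, hconn⟩ := mem_dualBelowR_iff.1 hf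
    have hbD : b ∈ D₀ := hD ▸ mem_dualBelowR_of_mem_dualBottomSide hb
    obtain ⟨W, hWS, hWω⟩ :=
      exists_walk_of_mem_openConnIn (fun _ h => h.1 : dualConfig ω' ⊆ (zdGraph 2).edgeSet) hconn
    obtain ⟨d, hd, hd1, hd2⟩ :=
      W.exists_boundary_dart (↑D₀ : Set (Site 2)) (Finset.mem_coe.2 hbD) (by simpa using hfD)
    have hopen' : s(d.fst, d.snd) ∈ dualConfig ω' :=
      hWω _ (by rw [Walk.edges]; exact List.mem_map.2 ⟨d, hd, rfl⟩)
    have hopen : s(d.fst, d.snd) ∈ dualConfig ω :=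
      (mem_dualConfig_iff_of_inter_eq h (Finset.mem_coe.1 hd1) (hopen'.1)).2 hopen'
    have := mem_dualBelowR_of_adj (hD.symm ▸ Finset.mem_coe.1 hd1 : d.fst ∈ dualBelowR M N ω)
      (hWS _ (W.dart_snd_mem_support_of_mem_darts hd)) hopen
    rw [hD] at this
    exact hd2 (Finset.mem_coe.2 this)
  · intro f hf
    have hf' : f ∈ dualBelowR M N ω := hD.symm ▸ hf
    obtain ⟨b, hb, hconn⟩ := exists_openConnIn_dualBelowR hf'
    rw [hD] at hconn
    obtain ⟨W, hWS, hWω⟩ :=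
      exists_walk_of_mem_openConnIn (fun _ h => h.1 : dualConfig ω ⊆ (zdGraph 2).edgeSet) hconn
    have hWω' : ∀ e ∈ W.edges, e ∈ dualConfig ω' := by
      intro e he
      rw [Walk.edges, List.mem_map] at he
      obtain ⟨d, hd, rfl⟩ := he
      have hopen : s(d.fst, d.snd) ∈ dualConfig ω :=
        hWω _ (by rw [Walk.edges]; exact List.mem_map.2 ⟨d, hd, rfl⟩)
      exact (mem_dualConfig_iff_of_inter_eq h
        (Finset.mem_coe.1 (hWS _ (W.dart_fst_mem_support_of_mem_darts hd))) hopen.1).1 hopen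
    have := mem_openConnIn_of_walk W (fun z hz => (hDR (Finset.mem_coe.1 (hWS z hz)) :
      z ∈ dualRectangle M N)) hWω'
    exact mem_dualBelowR_iff.2 ⟨hDR hf, b, hb, this⟩

/-- **Locality of the region below the lowest crossing**: `{dualBelowR M N ω = D₀}` is
determined by the edges bounding the faces of `D₀` ("the event `{LV(S) = P₁}` does not depend on
the states of bonds of `S` to the right of `P₁`", Bollobás–Riordan 2006, Ch. 3, proof of
Lemma 4). [cite: BollobasRiordan2006, Ch. 3, proof of Lemma 4] -/
theorem determinedBy_dualBelowR_eq (M N : ℕ) (D₀ : Finset (Site 2)) :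
    DeterminedBy {ω : BondConfig (Site 2) | dualBelowR M N ω = D₀} ↑(belowEdges D₀) := by
  rw [determinedBy_iff]
  intro ω ω' h
  exact ⟨dualBelowR_eq_of_inter_eq h, dualBelowR_eq_of_inter_eq h.symm⟩

/-- The event `{dualBelowR M N ω = D₀}` is measurable. [folklore] -/
theorem measurableSet_dualBelowR_eq (M N : ℕ) (D₀ : Finset (Site 2)) :
    MeasurableSet {ω : BondConfig (Site 2) | dualBelowR M N ω = D₀} :=
  (determinedBy_dualBelowR_eq M N D₀).measurableSet_of_finset

/-! ### The faces above the lowest crossing -/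

/-- The faces of `R*` off the region below. [folklore] -/
def offBelow (M N : ℕ) (ω : BondConfig (Site 2)) : Set (Site 2) :=
  {g | g ∈ dualRectangle M N ∧ g ∉ dualBelowR M N ω}

/-- **An above face**: a face of `R*` off the region below the lowest crossing, joined to the top
face row through faces of `R*` off that region (arbitrary steps): the region above the lowest
crossing ("the region above `c`, where percolation remains unbiased", Nolin 2008, proof of
Thm. 24 (ii)). [cite: Nolin2008, §5.2, proof of Thm. 24 (ii) (arXiv 0711.4948: Thm. 23 (ii), p. 17)] -/
def IsAboveFace (M N : ℕ) (ω : BondConfig (Site 2)) (f : Site 2) : Prop :=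
  ∃ t ∈ dualTopSide M N, (zdGraph 2).edgeSet ∈ openConnIn (offBelow M N ω) t f

/-- An above face lies off the region below. [folklore] -/
theorem IsAboveFace.mem_offBelow {f : Site 2} (h : IsAboveFace M N ω f) : f ∈ offBelow M N ω := by
  obtain ⟨t, -, -, hf, -⟩ := h
  exact hf

/-- An above face lies in `R*`. [folklore] -/
theorem IsAboveFace.mem_dualRectangle {f : Site 2} (h : IsAboveFace M N ω f) : f ∈ dualRectangle M N :=
  h.mem_offBelow.1

/-- An above face is not below. [folklore] -/
theorem IsAboveFace.not_mem_dualBelowR {f : Site 2} (h : IsAboveFace M N ω f) : f ∉ dualBelowR M N ω :=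
  h.mem_offBelow.2

/-- A top face off the region below is an above face. [folklore] -/
theorem isAboveFace_of_mem_dualTopSide {t : Site 2} (ht : t ∈ dualTopSide M N) (htB : t ∉ dualBelowR M N ω) :
    IsAboveFace M N ω t :=
  ⟨t, ht, openConnIn_refl ⟨(Finset.mem_filter.1 ht).1, htB⟩⟩

/-- Above faces propagate along steps inside `R*` off the region below. [folklore] -/
theorem IsAboveFace.of_adj {f f' : Site 2} (hf : IsAboveFace M N ω f) (h : (zdGraph 2).Adj f f')
    (hf' : f' ∈ dualRectangle M N) (hf'B : f' ∉ dualBelowR M N ω) : IsAboveFace M N ω f' := by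
  obtain ⟨t, ht, hconn⟩ := hf
  exact ⟨t, ht, PlanarDuality.openConnIn_trans hconn (openConnIn_of_adj hconn.2.1 ⟨hf', hf'B⟩ h h.ne)⟩

/-- A face of `R*` adjacent to an above face is above or below. [folklore] -/
theorem IsAboveFace.isAboveFace_or_mem_of_adj {f f' : Site 2} (hf : IsAboveFace M N ω f)
    (h : (zdGraph 2).Adj f f') (hf' : f' ∈ dualRectangle M N) :
    IsAboveFace M N ω f' ∨ f' ∈ dualBelowR M N ω := by
  by_cases hB : f' ∈ dualBelowR M N ω
  · exact Or.inr hB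
  · exact Or.inl (hf.of_adj h hf' hB)

/-- An above face is joined to the top face row by a lattice walk of faces off the region below.
[folklore] -/
theorem IsAboveFace.exists_walk {f : Site 2} (h : IsAboveFace M N ω f) :
    ∃ t ∈ dualTopSide M N, ∃ q : (zdGraph 2).Walk t f, ∀ z ∈ q.support, z ∈ offBelow M N ω := by
  obtain ⟨t, ht, hconn⟩ := h
  obtain ⟨q, hq, -⟩ := exists_walk_of_mem_openConnIn (subset_refl _) hconn
  exact ⟨t, ht, q, hq⟩

/-! ### The edges of the lowest crossing -/

/-- **A low edge**: a primal edge separating a face below the lowest crossing from an above face —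
an edge of the lowest open left–right crossing (Kesten 1982, §2.3: the lowest crossing is the
common boundary of the region below it and the region above it). [cite: KestenPTM1982, §2.2–2.3 (the lowest crossing)] -/
def IsLowEdge (M N : ℕ) (ω : BondConfig (Site 2)) (e : Sym2 (Site 2)) : Prop :=
  ∃ g f : Site 2, (zdGraph 2).Adj g f ∧ g ∈ dualBelowR M N ω ∧ IsAboveFace M N ω f ∧ e = sepEdge g f

/-- Low edges are lattice edges. [folklore] -/
theorem IsLowEdge.mem_edgeSet {e : Sym2 (Site 2)} (h : IsLowEdge M N ω e) : e ∈ (zdGraph 2).edgeSet := by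
  obtain ⟨g, f, hgf, -, -, rfl⟩ := h
  exact sepEdge_mem_edgeSet hgf

/-- **Low edges are open** (lattice configurations). [folklore] -/
theorem IsLowEdge.mem (hω : ω ⊆ (zdGraph 2).edgeSet) {e : Sym2 (Site 2)} (h : IsLowEdge M N ω e) : e ∈ ω := by
  obtain ⟨g, f, hgf, hg, hf, rfl⟩ := h
  exact mem_of_adj_dualBelowR hω hg hf.mem_dualRectangle hf.not_mem_dualBelowR hgf

/-- Separating edges determine the (unordered) pair of faces. [folklore] -/
theorem sepEdge_injective {z z' w w' : Site 2} (hz : (zdGraph 2).Adj z z') (hw : (zdGraph 2).Adj w w')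
    (h : sepEdge z z' = sepEdge w w') : s(z, z') = s(w, w') := by
  rw [← dualEdge_sepEdge hz, ← dualEdge_sepEdge hw, h]

/-- The endpoints of a low edge lie in `R`, provided no top face lies below. [folklore] -/
theorem IsLowEdge.mem_rectangle (hT : ∀ t ∈ dualTopSide M N, t ∉ dualBelowR M N ω) {e : Sym2 (Site 2)}
    (h : IsLowEdge M N ω e) : ∀ x ∈ e, x ∈ rectangle M N := by
  obtain ⟨g, f, hgf, hg, hf, rfl⟩ := h
  have hgR := mem_dualRectangle_iff.1 (dualBelowR_subset hg)
  have hfR := mem_dualRectangle_iff.1 hf.mem_dualRectangle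
  -- `g` is not a top face, `f` is not a bottom face
  have hgN : g 1 ≠ N := fun h1 => hT g (Finset.mem_filter.2 ⟨dualBelowR_subset hg, h1⟩) hg
  have hf1 : f 1 ≠ -1 := fun h1 =>
    hf.not_mem_dualBelowR (mem_dualBelowR_of_mem_dualBottomSide (Finset.mem_filter.2 ⟨hf.mem_dualRectangle, h1⟩))
  intro x hx
  rw [sepEdge, Sym2.mem_iff] at hx
  rw [mem_rectangle_iff]
  rcases ZdDual.sep_cases hgf with ⟨h0, h1, hlo0, hlo1, hhi0, hhi1⟩ | ⟨h0, h1, hlo0, hlo1, hhi0, hhi1⟩ |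
      ⟨h1, h0, hlo0, hlo1, hhi0, hhi1⟩ | ⟨h1, h0, hlo0, hlo1, hhi0, hhi1⟩
  all_goals
    rcases hx with rfl | rfl
    · rw [hlo0, hlo1]; omega
    · rw [hhi0, hhi1]; omega

/-! ### The lowest crossing: a left–right walk of low edges -/

/-- **The low edges carry a left–right crossing.** If `M ≥ 1` and no top face lies below, there
is a lattice walk of `R = [0,M] × [0,N]` from the left side to the right side all of whose edges
are low edges (the parity lemma `exists_faceWalk_of_bottom_top` applied, as in `exists_bdryWalk`,
to the faces of `R*` coloured "not above"; Bollobás–Riordan 2006, Ch. 3, Lemma 1; Kesten 1982,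
Prop. 2.3). [cite: BollobasRiordan2006, Ch. 3, Lemma 1] -/
theorem exists_lowWalk (hM : 1 ≤ M) (hT : ∀ t ∈ dualTopSide M N, t ∉ dualBelowR M N ω) :
    ∃ a b : Site 2, a 0 = 0 ∧ b 0 = M ∧ ∃ π : (zdGraph 2).Walk a b,
      (∀ z ∈ π.support, z ∈ rectangle M N) ∧ ∀ e ∈ π.edges, IsLowEdge M N ω e := by
  set c : Site 2 → Prop := fun z => ¬ IsAboveFace M N ω (z - Pi.single 1 1) with hc
  have hB : ∀ x ∈ bottomSide (M - 1) (N + 1), c x := by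
    intro x hx
    simp only [bottomSide, Finset.mem_filter, mem_rectangle_iff] at hx
    intro habove
    apply habove.not_mem_dualBelowR
    apply mem_dualBelowR_of_mem_dualBottomSide
    simp only [dualBottomSide, Finset.mem_filter, mem_dualRectangle_iff, Pi.sub_apply,
      single_one_apply_zero, single_one_apply_one]
    omega
  have hT' : ∀ x ∈ topSide (M - 1) (N + 1), ¬c x := by
    intro x hx
    simp only [topSide, Finset.mem_filter, mem_rectangle_iff] at hx
    simp only [hc, not_not]
    have hxt : x - Pi.single 1 1 ∈ dualTopSide M N := by
      simp only [dualTopSide, Finset.mem_filter, mem_dualRectangle_iff, Pi.sub_apply,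
        single_one_apply_zero, single_one_apply_one]
      omega
    exact isAboveFace_of_mem_dualTopSide hxt (hT _ hxt)
  obtain ⟨u, v, hu, hv, q, hq, hd⟩ := exists_faceWalk_of_bottom_top c (M - 1) (N + 1) hB hT'
  refine ⟨(zdShiftIso (Pi.single 0 1 : Site 2)).toEmbedding.toHom v,
    (zdShiftIso (Pi.single 0 1 : Site 2)).toEmbedding.toHom u, ?_, ?_,
    q.reverse.map (zdShiftIso (Pi.single 0 1 : Site 2)).toEmbedding.toHom, ?_, ?_⟩
  · show (v + Pi.single 0 1 : Site 2) 0 = 0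
    simp [hv]
  · show (u + Pi.single 0 1 : Site 2) 0 = M
    simp only [Pi.add_apply, single_zero_apply_zero, hu]
    omega
  · intro z hz
    rw [Walk.support_map, List.mem_map] at hz
    obtain ⟨w, hw, rfl⟩ := hz
    rw [Walk.support_reverse, List.mem_reverse] at hw
    have := hq w hw
    show w + Pi.single 0 1 ∈ rectangle M N
    simp only [mem_rectangle_iff, Pi.add_apply, single_zero_apply_zero, single_zero_apply_one]
    omega
  · intro e he
    rw [Walk.edges_map, List.mem_map] at he
    obtain ⟨e₁, he₁, rfl⟩ := he
    rw [Walk.edges_reverse, List.mem_reverse, Walk.edges, List.mem_map] at he₁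
    obtain ⟨d₀, hd₀, rfl⟩ := he₁
    obtain ⟨hlo, hhi, hcol⟩ := hd d₀ hd₀
    -- the two faces separated by the shifted edge
    set G : Site 2 := sepLo d₀.fst d₀.snd - Pi.single 1 1 with hG
    set F : Site 2 := sepHi d₀.fst d₀.snd - Pi.single 1 1 with hF
    have hedge : Sym2.map ((zdShiftIso (Pi.single 0 1 : Site 2)).toEmbedding.toHom) d₀.edge =
        s(d₀.fst + Pi.single 0 1, d₀.snd + Pi.single 0 1) := rfl
    rw [hedge]
    have hdual : dualEdge s(d₀.fst + Pi.single 0 1, d₀.snd + Pi.single 0 1) = s(G, F) :=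
      dualEdge_mk_add_single_zero d₀.adj
    simp only [mem_rectangle_iff] at hlo hhi
    have hGR : G ∈ dualRectangle M N := by
      simp only [hG, mem_dualRectangle_iff, Pi.sub_apply, single_one_apply_zero, single_one_apply_one]
      omega
    have hFR : F ∈ dualRectangle M N := by
      simp only [hF, mem_dualRectangle_iff, Pi.sub_apply, single_one_apply_zero, single_one_apply_one]
      omega
    have hE : s(d₀.fst + Pi.single 0 1, d₀.snd + Pi.single 0 1) ∈ (zdGraph 2).edgeSet :=
      (zdShiftIso (Pi.single 0 1 : Site 2)).map_adj_iff.2 d₀.adj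
    have hGF : (zdGraph 2).Adj G F := by
      have := dualEdge_mem_edgeSet_holds hE
      rwa [hdual] at this
    -- whichever of `G`, `F` is not above is below; the edge is `sepEdge` of the pair
    have key : ∀ {g f : Site 2}, (zdGraph 2).Adj g f → g ∈ dualRectangle M N → ¬ IsAboveFace M N ω g →
        IsAboveFace M N ω f → dualEdge s(d₀.fst + Pi.single 0 1, d₀.snd + Pi.single 0 1) = s(g, f) →
        IsLowEdge M N ω s(d₀.fst + Pi.single 0 1, d₀.snd + Pi.single 0 1) := by
      intro g f hgf hgR hg hf hde
      have hgB : g ∈ dualBelowR M N ω := by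
        rcases hf.isAboveFace_or_mem_of_adj hgf.symm hgR with h | h
        · exact absurd h hg
        · exact h
      refine ⟨g, f, hgf, hgB, hf, ?_⟩
      apply dualEdge_injOn_holds hE (sepEdge_mem_edgeSet hgf)
      rw [hde, dualEdge_sepEdge hgf]
    by_cases hGa : IsAboveFace M N ω G
    · have hFa : ¬ IsAboveFace M N ω F := fun h => hcol.2 (fun hn => hn h) hGa
      exact key hGF.symm hFR hFa hGa (by rw [hdual, Sym2.eq_swap])
    · have hFa : IsAboveFace M N ω F := not_not.1 (hcol.1 hGa)
      exact key hGF hGR hGa hFa hdual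

/-- **Every low edge lies on every left–right walk of low edges** (hence the low edges are
exactly the edges of any such walk): the dual top–bottom walk "top face row → above faces → `f` →
`g` → below faces → bottom face row" through the low edge `sepEdge g f` must cross an edge of the
walk (`exists_dart_sepEdge_mem_edges`), and its only step across a low edge is `f → g` (Kesten
1982, §2.3: the lowest crossing is unique). [cite: KestenPTM1982, §2.2–2.3 (the lowest crossing)] -/
theorem IsLowEdge.mem_edges_of_walk {a b : Site 2}
    (P : (zdGraph 2).Walk a b) (hP : ∀ z ∈ P.support, z ∈ rectangle M N) (ha : a 0 = 0) (hb : b 0 = M)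
    (hPe : ∀ e ∈ P.edges, IsLowEdge M N ω e) {e : Sym2 (Site 2)} (he : IsLowEdge M N ω e) :
    e ∈ P.edges := by
  classical
  obtain ⟨g, f, hgf, hg, hf, rfl⟩ := he
  -- the dual walk: top → f (off the region below), f → g, g → bottom (inside the region below)
  obtain ⟨t, ht, q₁, hq₁⟩ := hf.exists_walk
  obtain ⟨b', hb', hconn⟩ := exists_openConnIn_dualBelowR hg
  obtain ⟨q₃, hq₃, hq₃ω⟩ :=
    exists_walk_of_mem_openConnIn (fun _ h => h.1 : dualConfig ω ⊆ (zdGraph 2).edgeSet) hconn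
  set Q : (zdGraph 2).Walk t b' := q₁.append (Walk.cons hgf.symm q₃.reverse) with hQ
  have ht1 : t 1 = N := (Finset.mem_filter.1 ht).2
  have hb'1 : b' 1 = -1 := (Finset.mem_filter.1 hb').2
  have hQs : ∀ z ∈ Q.support, 0 ≤ z 0 ∧ z 0 + 1 ≤ M ∧ -1 ≤ z 1 ∧ z 1 ≤ N := by
    intro z hz
    have hzR : z ∈ dualRectangle M N := by
      rw [hQ, Walk.mem_support_append_iff, Walk.support_cons, List.mem_cons, Walk.support_reverse,
        List.mem_reverse] at hz
      rcases hz with hz | rfl | hz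
      · exact (hq₁ z hz).1
      · exact hf.mem_dualRectangle
      · exact dualBelowR_subset (Finset.mem_coe.1 (hq₃ _ hz))
    have := mem_dualRectangle_iff.1 hzR
    omega
  have hP' : ∀ z ∈ P.support, 0 ≤ z 0 ∧ z 0 ≤ M ∧ 0 ≤ z 1 ∧ z 1 ≤ N := fun z hz =>
    mem_rectangle_iff.1 (hP z hz)
  obtain ⟨dq, hdq, hdqP⟩ := exists_dart_sepEdge_mem_edges P Q hP' hQs ha hb ht1 hb'1
  -- the crossed edge is a low edge `sepEdge g' f'`; so `{dq.fst, dq.snd} = {g', f'}`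
  obtain ⟨g', f', hg'f', hg', hf', heq⟩ := hPe _ hdqP
  have hpair : s(dq.fst, dq.snd) = s(g', f') := sepEdge_injective dq.adj hg'f' heq
  have hbelow : dq.fst ∈ dualBelowR M N ω ∨ dq.snd ∈ dualBelowR M N ω := by
    rcases Sym2.eq_iff.1 hpair with ⟨h1, -⟩ | ⟨-, h2⟩
    · exact Or.inl (h1 ▸ hg')
    · exact Or.inr (h2 ▸ hg')
  have habove : IsAboveFace M N ω dq.fst ∨ IsAboveFace M N ω dq.snd := by
    rcases Sym2.eq_iff.1 hpair with ⟨-, h2⟩ | ⟨h1, -⟩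
    · exact Or.inr (h2 ▸ hf')
    · exact Or.inl (h1 ▸ hf')
  -- locate the dart
  rw [hQ, Walk.darts_append, List.mem_append, Walk.darts_cons, List.mem_cons, Walk.darts_reverse,
    List.mem_reverse, List.mem_map] at hdq
  rcases hdq with hdq | rfl | ⟨d₃, hd₃, rfl⟩
  · -- inside the above part: no face is below
    exfalso
    rcases hbelow with h | h
    · exact (hq₁ _ (q₁.dart_fst_mem_support_of_mem_darts hdq)).2 h
    · exact (hq₁ _ (q₁.dart_snd_mem_support_of_mem_darts hdq)).2 h
  · -- the step `f → g`
    rw [sepEdge_comm]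
    exact hdqP
  · -- inside the below part: no face is above
    exfalso
    rcases habove with h | h
    · exact h.not_mem_dualBelowR (Finset.mem_coe.1 (hq₃ _ (by
        simpa using q₃.dart_snd_mem_support_of_mem_darts hd₃)))
    · exact h.not_mem_dualBelowR (Finset.mem_coe.1 (hq₃ _ (by
        simpa using q₃.dart_fst_mem_support_of_mem_darts hd₃)))

/-! ### The lowest crossing as a simple path -/

/-- **The lowest open left–right crossing of `R = [0,M] × [0,N]`**: a simple lattice path of `R`
from the left side to the right side whose edge set is exactly the set of low edges (Kesten 1982,
Prop. 2.3; Bollobás–Riordan 2006, Ch. 3, remark after Lemma 1). [cite: KestenPTM1982, §2.2–2.3 (the lowest crossing)] -/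
structure LowPath (M N : ℕ) (ω : BondConfig (Site 2)) where
  /-- left end -/
  a : Site 2
  /-- right end -/
  b : Site 2
  /-- the path -/
  path : (zdGraph 2).Walk a b
  isPath : path.IsPath
  left : a 0 = 0
  right : b 0 = M
  mem_rectangle : ∀ z ∈ path.support, z ∈ rectangle M N
  mem_edges_iff : ∀ e, e ∈ path.edges ↔ IsLowEdge M N ω e

/-- **The lowest crossing exists** when `M ≥ 1` and no top face lies below (shortcut the walk of
`exists_lowWalk` to a path; its edges are still low, and every low edge is one of them by
`IsLowEdge.mem_edges_of_walk`). [cite: KestenPTM1982, §2.2–2.3 (the lowest crossing)] -/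
theorem nonempty_lowPath (hM : 1 ≤ M) (hT : ∀ t ∈ dualTopSide M N, t ∉ dualBelowR M N ω) :
    Nonempty (LowPath M N ω) := by
  obtain ⟨a, b, ha, hb, π, hπ, hπe⟩ := exists_lowWalk hM hT
  have hs : ∀ z ∈ π.bypass.support, z ∈ rectangle M N := fun z hz => hπ z (π.support_bypass_subset_support hz)
  have he : ∀ e ∈ π.bypass.edges, IsLowEdge M N ω e := fun e he => hπe e (π.edges_bypass_subset_edges he)
  exact ⟨⟨a, b, π.bypass, π.bypass_isPath, ha, hb, hs, fun e =>
    ⟨he e, fun hle => hle.mem_edges_of_walk π.bypass hs ha hb he⟩⟩⟩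

/-! ### Vertices: on the lowest crossing, above it -/

/-- A vertex of the lowest crossing: an endpoint of a low edge. [folklore] -/
def IsLowVertex (M N : ℕ) (ω : BondConfig (Site 2)) (p : Site 2) : Prop :=
  ∃ e, IsLowEdge M N ω e ∧ p ∈ e

/-- **A vertex above the lowest crossing**: a vertex of `R` off the lowest crossing around which
some face is an above face. [cite: Nolin2008, §5.2, proof of Thm. 24 (ii) (arXiv 0711.4948: Thm. 23 (ii), p. 17)] -/
def IsAboveVertex (M N : ℕ) (ω : BondConfig (Site 2)) (p : Site 2) : Prop :=
  p ∈ rectangle M N ∧ ¬ IsLowVertex M N ω p ∧ ∃ z ∈ cornerFaces p, IsAboveFace M N ω z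

namespace LowPath

variable (Λ : LowPath M N ω)

/-- The vertices of the lowest crossing are the low vertices (`M ≥ 1`). [folklore] -/
theorem mem_support_iff (hM : 1 ≤ M) {p : Site 2} : p ∈ Λ.path.support ↔ IsLowVertex M N ω p := by
  have hnil : ¬ Λ.path.Nil := by
    intro h
    have h1 := Λ.left
    have h2 := Λ.right
    rw [h.eq] at h1
    omega
  rw [Walk.mem_support_iff_exists_mem_edges_of_not_nil hnil]
  constructor
  · rintro ⟨e, he, hpe⟩
    exact ⟨e, (Λ.mem_edges_iff e).1 he, hpe⟩
  · rintro ⟨e, he, hpe⟩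
    exact ⟨e, (Λ.mem_edges_iff e).2 he, hpe⟩

/-- The edges of the lowest crossing are open (lattice configurations). [folklore] -/
theorem mem_of_mem_edges (hω : ω ⊆ (zdGraph 2).edgeSet) {e : Sym2 (Site 2)} (he : e ∈ Λ.path.edges) :
    e ∈ ω :=
  ((Λ.mem_edges_iff e).1 he).mem hω

/-- Distinct indices give distinct vertices. [folklore] -/
theorem getVert_injective {i j : ℕ} (hi : i ≤ Λ.path.length) (hj : j ≤ Λ.path.length)
    (h : Λ.path.getVert i = Λ.path.getVert j) : i = j :=
  Λ.isPath.getVert_injOn hi hj h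

/-- Consecutive vertices span an edge of the path. [folklore] -/
theorem mk_getVert_mem_edges {k : ℕ} (hk : k < Λ.path.length) :
    s(Λ.path.getVert k, Λ.path.getVert (k + 1)) ∈ Λ.path.edges := by
  have hlen : k < Λ.path.darts.length := by rw [Walk.length_darts]; exact hk
  have hd : Λ.path.darts[k] ∈ Λ.path.darts := List.getElem_mem hlen
  rw [Walk.darts_getElem_eq_getVert k hlen] at hd
  exact List.mem_map.2 ⟨_, hd, rfl⟩

/-- Every edge of the path is spanned by consecutive vertices. [folklore] -/
theorem exists_eq_mk_getVert {e : Sym2 (Site 2)} (he : e ∈ Λ.path.edges) :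
    ∃ k < Λ.path.length, e = s(Λ.path.getVert k, Λ.path.getVert (k + 1)) := by
  rw [Walk.edges, List.mem_map] at he
  obtain ⟨d, hd, rfl⟩ := he
  obtain ⟨k, hk, hdk⟩ := List.getElem_of_mem hd
  refine ⟨k, by rw [Walk.length_darts] at hk; exact hk, ?_⟩
  rw [← hdk, Walk.darts_getElem_eq_getVert k hk]
  rfl

/-- **An edge between two vertices of the lowest crossing that lies on it joins consecutive
vertices.** [folklore] -/
theorem eq_succ_or_eq_succ_of_mem_edges {i j : ℕ} (hi : i ≤ Λ.path.length) (hj : j ≤ Λ.path.length)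
    (he : s(Λ.path.getVert i, Λ.path.getVert j) ∈ Λ.path.edges) : j = i + 1 ∨ i = j + 1 := by
  obtain ⟨k, hk, heq⟩ := Λ.exists_eq_mk_getVert he
  rcases Sym2.eq_iff.1 heq with ⟨h1, h2⟩ | ⟨h1, h2⟩
  · have := Λ.getVert_injective hi hk.le h1
    have := Λ.getVert_injective hj hk h2
    omega
  · have := Λ.getVert_injective hi hk h1
    have := Λ.getVert_injective hj hk.le h2
    omega

end LowPath

/-! ### Local geometry of the faces around a vertex -/

/-- The two faces separated by an edge at `v` are faces around `v`. [folklore] -/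
theorem cornerFaces_of_mem_sepEdge {v z z' : Site 2} (h : (zdGraph 2).Adj z z') (hv : v ∈ sepEdge z z') :
    z ∈ cornerFaces v ∧ z' ∈ cornerFaces v := by
  rw [sepEdge, Sym2.mem_iff] at hv
  simp only [mem_cornerFaces_iff]
  rcases ZdDual.sep_cases h with ⟨h0, h1, hlo0, hlo1, hhi0, hhi1⟩ | ⟨h0, h1, hlo0, hlo1, hhi0, hhi1⟩ |
      ⟨h1, h0, hlo0, hlo1, hhi0, hhi1⟩ | ⟨h1, h0, hlo0, hlo1, hhi0, hhi1⟩
  all_goals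
    rcases hv with rfl | rfl
    · omega
    · omega

/-- The four faces around `p`, as an explicit disjunction. [folklore] -/
theorem eq_of_mem_cornerFaces {p z : Site 2} (hz : z ∈ cornerFaces p) :
    z = p ∨ z = p - Pi.single 0 1 ∨ z = p - Pi.single 1 1 ∨ z = p - Pi.single 0 1 - Pi.single 1 1 := by
  obtain ⟨h0, h1⟩ := hz
  rcases h0 with h0 | h0 <;> rcases h1 with h1 | h1
  · left; simp [LatticeModels.Site.eq_iff_two, h0, h1]
  · right; right; left; simp [LatticeModels.Site.eq_iff_two, h0, ← h1]
  · right; left; simp [LatticeModels.Site.eq_iff_two, ← h0, h1]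
  · right; right; right; simp [LatticeModels.Site.eq_iff_two, ← h0, ← h1]

section Corner

variable (p : Site 2)

/-- The faces `p` and `p - e₀` are adjacent. [folklore] -/
theorem ZdCorner.adj_NE_NW : (zdGraph 2).Adj p (p - Pi.single 0 1) :=
  adj_of_stepKind (.left (by simp) (by simp))
/-- The faces `p` and `p - e₁` are adjacent. [folklore] -/
theorem ZdCorner.adj_NE_SE : (zdGraph 2).Adj p (p - Pi.single 1 1) := adj_sub_single_one p
/-- The faces `p - e₀` and `p - e₀ - e₁` are adjacent. [folklore] -/
theorem ZdCorner.adj_NW_SW : (zdGraph 2).Adj (p - Pi.single 0 1) (p - Pi.single 0 1 - Pi.single 1 1) :=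
  adj_sub_single_one _
/-- The faces `p - e₁` and `p - e₀ - e₁` are adjacent. [folklore] -/
theorem ZdCorner.adj_SE_SW : (zdGraph 2).Adj (p - Pi.single 1 1) (p - Pi.single 0 1 - Pi.single 1 1) :=
  adj_of_stepKind (.left (by simp) (by simp))
/-- `p` is a face around `p` (north-east). [folklore] -/
theorem ZdCorner.NE_mem : p ∈ cornerFaces p := by simp [mem_cornerFaces_iff]
/-- `p - e₀` is a face around `p` (north-west). [folklore] -/
theorem ZdCorner.NW_mem : p - Pi.single 0 1 ∈ cornerFaces p := by simp [mem_cornerFaces_iff]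
/-- `p - e₁` is a face around `p` (south-east). [folklore] -/
theorem ZdCorner.SE_mem : p - Pi.single 1 1 ∈ cornerFaces p := by simp [mem_cornerFaces_iff]
/-- `p - e₀ - e₁` is a face around `p` (south-west). [folklore] -/
theorem ZdCorner.SW_mem : p - Pi.single 0 1 - Pi.single 1 1 ∈ cornerFaces p := by simp [mem_cornerFaces_iff]

end Corner

/-- One step around an above vertex: from an above face around `p` to an adjacent face of `R*`
around `p` (which is then above, for otherwise the edge between them would be a low edge at `p`).
[folklore] -/
theorem IsAboveVertex.isAboveFace_step {p z z' : Site 2} (hp : IsAboveVertex M N ω p)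
    (hz : z ∈ cornerFaces p) (hz' : z' ∈ cornerFaces p) (hzz' : (zdGraph 2).Adj z z')
    (hza : IsAboveFace M N ω z) (hz'R : z' ∈ dualRectangle M N) : IsAboveFace M N ω z' := by
  rcases hza.isAboveFace_or_mem_of_adj hzz' hz'R with h | h
  · exact h
  · exact absurd ⟨sepEdge z' z, ⟨z', z, hzz'.symm, h, hza, rfl⟩, mem_sepEdge_of_cornerFaces hz' hz hzz'.symm⟩ hp.2.1

/-- **Around an above vertex every face of `R*` is an above face.** [folklore] -/
theorem IsAboveVertex.isAboveFace_of_corner {p z' : Site 2} (hp : IsAboveVertex M N ω p)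
    (hz' : z' ∈ cornerFaces p) (hz'R : z' ∈ dualRectangle M N) : IsAboveFace M N ω z' := by
  obtain ⟨hpR, -, z, hz, hza⟩ := id hp
  have hzR := mem_dualRectangle_iff.1 hza.mem_dualRectangle
  have hz'R' := mem_dualRectangle_iff.1 hz'R
  have hpR' := mem_rectangle_iff.1 hpR
  -- membership of the intermediate faces in `R*`, in coordinates
  have hNE : p 0 ≤ (M : ℤ) - 1 → p ∈ dualRectangle M N := fun h => by
    rw [mem_dualRectangle_iff]; omega
  have hNW : 1 ≤ p 0 → p - Pi.single 0 1 ∈ dualRectangle M N := fun h => by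
    simp only [mem_dualRectangle_iff, Pi.sub_apply, single_zero_apply_zero, single_zero_apply_one]; omega
  have step := fun {w w' : Site 2} (hw : w ∈ cornerFaces p) (hw' : w' ∈ cornerFaces p)
    (hww' : (zdGraph 2).Adj w w') (hwa : IsAboveFace M N ω w) (hw'R : w' ∈ dualRectangle M N) =>
    hp.isAboveFace_step hw hw' hww' hwa hw'R
  rcases eq_of_mem_cornerFaces hz with rfl | rfl | rfl | rfl <;>
    rcases eq_of_mem_cornerFaces hz' with rfl | rfl | rfl | rfl
  -- z = NE
  · exact hza
  · exact step (ZdCorner.NE_mem _) (ZdCorner.NW_mem _) (ZdCorner.adj_NE_NW _) hza hz'R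
  · exact step (ZdCorner.NE_mem _) (ZdCorner.SE_mem _) (ZdCorner.adj_NE_SE _) hza hz'R
  · simp only [Pi.sub_apply, single_zero_apply_zero, single_one_apply_zero] at hz'R'
    exact step (ZdCorner.NW_mem _) (ZdCorner.SW_mem _) (ZdCorner.adj_NW_SW _)
      (step (ZdCorner.NE_mem _) (ZdCorner.NW_mem _) (ZdCorner.adj_NE_NW _) hza (hNW (by omega))) hz'R
  -- z = NW
  · exact step (ZdCorner.NW_mem _) (ZdCorner.NE_mem _) (ZdCorner.adj_NE_NW _).symm hza hz'R
  · exact hza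
  · simp only [Pi.sub_apply, single_one_apply_zero] at hz'R'
    exact step (ZdCorner.NE_mem _) (ZdCorner.SE_mem _) (ZdCorner.adj_NE_SE _)
      (step (ZdCorner.NW_mem _) (ZdCorner.NE_mem _) (ZdCorner.adj_NE_NW _).symm hza (hNE (by omega))) hz'R
  · exact step (ZdCorner.NW_mem _) (ZdCorner.SW_mem _) (ZdCorner.adj_NW_SW _) hza hz'R
  -- z = SE
  · exact step (ZdCorner.SE_mem _) (ZdCorner.NE_mem _) (ZdCorner.adj_NE_SE _).symm hza hz'R
  · simp only [Pi.sub_apply, single_one_apply_zero] at hzR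
    exact step (ZdCorner.NE_mem _) (ZdCorner.NW_mem _) (ZdCorner.adj_NE_NW _)
      (step (ZdCorner.SE_mem _) (ZdCorner.NE_mem _) (ZdCorner.adj_NE_SE _).symm hza (hNE (by omega))) hz'R
  · exact hza
  · exact step (ZdCorner.SE_mem _) (ZdCorner.SW_mem _) (ZdCorner.adj_SE_SW _) hza hz'R
  -- z = SW
  · simp only [Pi.sub_apply, single_zero_apply_zero, single_one_apply_zero] at hzR
    exact step (ZdCorner.NW_mem _) (ZdCorner.NE_mem _) (ZdCorner.adj_NE_NW _).symm
      (step (ZdCorner.SW_mem _) (ZdCorner.NW_mem _) (ZdCorner.adj_NW_SW _).symm hza (hNW (by omega))) hz'R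
  · exact step (ZdCorner.SW_mem _) (ZdCorner.NW_mem _) (ZdCorner.adj_NW_SW _).symm hza hz'R
  · exact step (ZdCorner.SW_mem _) (ZdCorner.SE_mem _) (ZdCorner.adj_SE_SW _).symm hza hz'R
  · exact hza

/-- The faces of an edge of `R`: for adjacent `p, q ∈ R` (`M ≥ 1`) there is a face of `R*` around
both `p` and `q` (one of the two faces separated by the edge). [folklore] -/
theorem exists_cornerFace_of_adj (hM : 1 ≤ M) {p q : Site 2} (hp : p ∈ rectangle M N) (hq : q ∈ rectangle M N)
    (h : (zdGraph 2).Adj p q) : ∃ z ∈ cornerFaces p, z ∈ cornerFaces q ∧ z ∈ dualRectangle M N := by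
  have hpR := mem_rectangle_iff.1 hp
  have hqR := mem_rectangle_iff.1 hq
  rcases stepKind_of_adj h with ⟨h0, h1⟩ | ⟨h0, h1⟩ | ⟨h1, h0⟩ | ⟨h1, h0⟩
  · -- q = p + e₀ : the face `p`
    refine ⟨p, ZdCorner.NE_mem p, ?_, ?_⟩
    · simp only [mem_cornerFaces_iff]; omega
    · rw [mem_dualRectangle_iff]; omega
  · -- p = q + e₀ : the face `q`
    refine ⟨q, ?_, ZdCorner.NE_mem q, ?_⟩
    · simp only [mem_cornerFaces_iff]; omega
    · rw [mem_dualRectangle_iff]; omega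
  · -- q = p + e₁ : the face `p` or `p - e₀`
    by_cases hx : p 0 ≤ (M : ℤ) - 1
    · refine ⟨p, ZdCorner.NE_mem p, ?_, ?_⟩
      · simp only [mem_cornerFaces_iff]; omega
      · rw [mem_dualRectangle_iff]; omega
    · refine ⟨p - Pi.single 0 1, ZdCorner.NW_mem p, ?_, ?_⟩
      · simp only [mem_cornerFaces_iff, Pi.sub_apply, single_zero_apply_zero, single_zero_apply_one]; omega
      · simp only [mem_dualRectangle_iff, Pi.sub_apply, single_zero_apply_zero, single_zero_apply_one]; omega
  · -- p = q + e₁ : the face `q` or `q - e₀`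
    by_cases hx : q 0 ≤ (M : ℤ) - 1
    · refine ⟨q, ?_, ZdCorner.NE_mem q, ?_⟩
      · simp only [mem_cornerFaces_iff]; omega
      · rw [mem_dualRectangle_iff]; omega
    · refine ⟨q - Pi.single 0 1, ?_, ZdCorner.NW_mem q, ?_⟩
      · simp only [mem_cornerFaces_iff, Pi.sub_apply, single_zero_apply_zero, single_zero_apply_one]; omega
      · simp only [mem_dualRectangle_iff, Pi.sub_apply, single_zero_apply_zero, single_zero_apply_one]; omega

/-- **No vertex above the lowest crossing is adjacent to a vertex below it**: a neighbour in `R`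
of an above vertex is an above vertex or a vertex of the lowest crossing. [folklore] -/
theorem IsAboveVertex.of_adj (hM : 1 ≤ M) {p q : Site 2} (hp : IsAboveVertex M N ω p)
    (hq : q ∈ rectangle M N) (h : (zdGraph 2).Adj p q) (hnl : ¬ IsLowVertex M N ω q) :
    IsAboveVertex M N ω q := by
  obtain ⟨z, hzp, hzq, hzR⟩ := exists_cornerFace_of_adj hM hp.1 hq h
  exact ⟨hq, hnl, z, hzq, hp.isAboveFace_of_corner hzp hzR⟩

/-- A vertex of the lowest crossing has a face below around it (a face of the low edge at it).
[folklore] -/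
theorem IsLowVertex.exists_cornerFace_mem {p : Site 2} (hp : IsLowVertex M N ω p) :
    ∃ g ∈ cornerFaces p, g ∈ dualBelowR M N ω := by
  obtain ⟨e, ⟨g, f, hgf, hg, -, rfl⟩, hpe⟩ := hp
  exact ⟨g, (cornerFaces_of_mem_sepEdge hgf hpe).1, hg⟩

/-- A vertex of the lowest crossing has an above face around it. [folklore] -/
theorem IsLowVertex.exists_cornerFace_isAboveFace {p : Site 2} (hp : IsLowVertex M N ω p) :
    ∃ f ∈ cornerFaces p, IsAboveFace M N ω f := by
  obtain ⟨e, ⟨g, f, hgf, -, hf, rfl⟩, hpe⟩ := hp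
  exact ⟨f, (cornerFaces_of_mem_sepEdge hgf hpe).2, hf⟩

/-- An above vertex has no face below around it. [folklore] -/
theorem IsAboveVertex.not_mem_of_cornerFaces {p z : Site 2} (hp : IsAboveVertex M N ω p)
    (hz : z ∈ cornerFaces p) : z ∉ dualBelowR M N ω := fun hzB =>
  (hp.isAboveFace_of_corner hz (dualBelowR_subset hzB)).not_mem_dualBelowR hzB

/-- **A vertex of `R` with an above face around it and no face below around it is an above
vertex.** [folklore] -/
theorem isAboveVertex_of_forall_not_mem {p : Site 2} (hp : p ∈ rectangle M N)
    (hno : ∀ z ∈ cornerFaces p, z ∉ dualBelowR M N ω) (hz : ∃ z ∈ cornerFaces p, IsAboveFace M N ω z) :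
    IsAboveVertex M N ω p := by
  refine ⟨hp, fun hl => ?_, hz⟩
  obtain ⟨g, hg, hgB⟩ := hl.exists_cornerFace_mem
  exact hno g hg hgB

/-! ### Feet of the lowest crossing: open attachments from the top side, closed dual paths from the top face row -/

/-- **Joined to the top side above the lowest crossing**: `p` is an above vertex joined to a
vertex of the top side of `R` by an OPEN lattice walk all of whose vertices are above vertices
(Nolin 2008, proof of Thm. 24 (ii): "connected to the top side by a black path" in the region
above the lowest crossing). [cite: Nolin2008, §5.2, proof of Thm. 24 (ii) (arXiv 0711.4948: Thm. 23 (ii), p. 17)] -/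
def IsTopJoinedAbove (M N : ℕ) (ω : BondConfig (Site 2)) (p : Site 2) : Prop :=
  ∃ t ∈ topSide M N, ∃ q : (zdGraph 2).Walk t p,
    (∀ z ∈ q.support, IsAboveVertex M N ω z) ∧ ∀ e ∈ q.edges, e ∈ ω

/-- **An attachment** of the region above to the vertex `v` (of the lowest crossing): a neighbour
`t` of `v`, joined to the top side above the lowest crossing, with the edge `{t, v}` OPEN
(Nolin's `v₁`: "the respective sites on `c` where they arrive"). [cite: Nolin2008, §5.2, proof of Thm. 24 (ii) (arXiv 0711.4948: Thm. 23 (ii), p. 17)] -/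
def IsAttachedLow (M N : ℕ) (ω : BondConfig (Site 2)) (v : Site 2) : Prop :=
  ∃ t, IsTopJoinedAbove M N ω t ∧ (zdGraph 2).Adj t v ∧ s(t, v) ∈ ω

/-- **A dual foot at `v`**: a face around `v` is joined to the top face row of `R*` by a dual-open
(= crossing closed edges) path of `R*` (Nolin's white path from the top side arriving at `v₂`;
here it is also the certificate that `v` is pivotal for the left–right crossing of `R`). [cite: Nolin2008, §5.2, proof of Thm. 24 (ii) (arXiv 0711.4948: Thm. 23 (ii), p. 17)] -/
def HasDualFootAt (M N : ℕ) (ω : BondConfig (Site 2)) (v : Site 2) : Prop :=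
  ∃ t ∈ dualTopSide M N, ∃ f ∈ cornerFaces v,
    dualConfig ω ∈ openConnIn (↑(dualRectangle M N) : Set (Site 2)) t f

/-- **The configuration used to find the fifth arm** at the vertex `v`: the open edges having an
above face on one side, except the edges at `v` (the bond analogue of the colouring of
`LowSeq.isFootK_of_gap`, `FiveArmSite.lean`: open sites of the region above together with the
sites of the lowest crossing, minus the site `κ i`). [folklore] -/
def footConfig (M N : ℕ) (ω : BondConfig (Site 2)) (v : Site 2) : BondConfig (Site 2) :=
  {e | e ∈ ω ∧ (∃ z ∈ dualEdge e, IsAboveFace M N ω z) ∧ v ∉ e}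

/-- `footConfig ⊆ ω`. [folklore] -/
theorem footConfig_subset (v : Site 2) : footConfig M N ω v ⊆ ω := fun _ h => h.1

/-- Membership in `footConfig`. [folklore] -/
theorem mem_footConfig_iff {v : Site 2} {e : Sym2 (Site 2)} :
    e ∈ footConfig M N ω v ↔ e ∈ ω ∧ (∃ z ∈ dualEdge e, IsAboveFace M N ω z) ∧ v ∉ e := Iff.rfl

/-- A vertex joined to the top side above is an above vertex. [folklore] -/
theorem IsTopJoinedAbove.isAboveVertex {p : Site 2} (h : IsTopJoinedAbove M N ω p) : IsAboveVertex M N ω p := by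
  obtain ⟨t, -, q, hq, -⟩ := h
  exact hq p q.end_mem_support

/-- Extension of `IsTopJoinedAbove` along an open edge to an above vertex. [folklore] -/
theorem IsTopJoinedAbove.of_adj {p q : Site 2} (h : IsTopJoinedAbove M N ω p) (hpq : (zdGraph 2).Adj p q)
    (he : s(p, q) ∈ ω) (hq : IsAboveVertex M N ω q) : IsTopJoinedAbove M N ω q := by
  obtain ⟨t, ht, w, hw, hwe⟩ := h
  refine ⟨t, ht, w.concat hpq, fun z hz => ?_, fun e he' => ?_⟩
  · rw [Walk.support_concat, List.mem_append, List.mem_singleton] at hz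
    rcases hz with hz | rfl
    · exact hw z hz
    · exact hq
  · rw [Walk.edges_concat, List.concat_eq_append, List.mem_append, List.mem_singleton] at he'
    rcases he' with he' | rfl
    · exact hwe e he'
    · exact he

/-- Extension of `IsTopJoinedAbove` along an open walk of above vertices. [folklore] -/
theorem IsTopJoinedAbove.of_walk {p q : Site 2} (h : IsTopJoinedAbove M N ω p) (w : (zdGraph 2).Walk p q)
    (hw : ∀ z ∈ w.support, IsAboveVertex M N ω z) (hwe : ∀ e ∈ w.edges, e ∈ ω) :
    IsTopJoinedAbove M N ω q := by
  induction w with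
  | nil => exact h
  | cons hadj w' ih =>
    rename_i x y z
    refine ih (h.of_adj hadj (hwe _ (by simp)) (hw y (by simp))) (fun u hu => hw u (by simp [hu]))
      (fun e he => hwe e (by simp [he]))

end Literature.Probability.Percolation

end
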